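import Summits.Ventures.PercRepro.S1CoreCapSixOneCases

/-!
# PercRepro — TOWARDS `Q*(6) = 16`: ONE BIG LINE, THE ASSEMBLY (p1, gen 25)

The last case of one big line `A` (`S1CoreCapSixOne`, `S1CoreCapSixOneCases`): at most one fat point off `A`. In
terms of `k = 8 − |A| − fat A`: the fat points of `A` (at most `fat A`) have degree `≤ k`; with no new fat point
`2 · #T ≤ k (k + 1)`; with one new fat point `q` there are `≤ k − 1` lines through `q` and the lines avoiding it
have `≤ k − 2` free lines (`bounds_of_one_new_fat`). By the shape of `A` — `(4,0)` with `k = 4`, `(5,0)` and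
`(4,1)` with `k = 3` — the cap sum is `≤ 4 + 10`, `≤ 5 + 6`, `≤ 5 + 6 + 3`; with the two earlier cases this is
`sum_cap_le_sixteen_of_one_big`. `proofs/P1-S4-CAPBRIDGE.md` §17. Axioms: standard.
-/

namespace PercRepro

namespace S1

namespace FourCap

variable {β : Type} [DecidableEq β]

section OneBigFinal

variable {w : β → ℕ} {ls : Finset (Finset β)}
  (h1 : ∀ L ∈ ls, ∀ v ∈ L, w v = 1 ∨ w v = 2)
  (h2 : ∀ L ∈ ls, 3 ≤ L.card ∧ wsum w L ≤ 5)
  (h3 : ∀ L ∈ ls, ∀ L' ∈ ls, L ≠ L' → (L ∩ L').card ≤ 1)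
  (h4 : ∀ l : List (Finset β), l.Nodup → (∀ L ∈ l, L ∈ ls) → wsum w (unionL l) ≤ 6 + lineRank l)
  {A : Finset β} (hA : A ∈ ls) (cA : 4 ≤ A.card)
  (hrest : ∀ L ∈ ls, L ≠ A → L.card = 3)

include h1 h2 h3 h4 hA hrest in
/-- **(β″) At most one new fat point**: the degree sums of the fat points of `A` and off `A`, and the line count,
in terms of `k = 8 − |A| − fat A` and `k' = k − 2`. -/
theorem bounds_of_one_new_fat (hone : ∀ q r : β, q ∉ A → r ∉ A → w q = 2 → w r = 2 →
      (∃ B ∈ ls, B ≠ A ∧ q ∈ B) → (∃ C ∈ ls, C ≠ A ∧ r ∈ C) → q = r)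
    {k k' : ℕ} (hk : k + A.card + fat w A = 8) (hk' : k' + A.card + fat w A + 2 = 8) :
    (∑ v ∈ (fatPoints w (ls.erase A)).filter (fun v => v ∈ A), ((ls.erase A).filter (fun L => v ∈ L)).card
        ≤ fat w A * k) ∧
    (2 * ((ls.erase A).card +
        ∑ v ∈ (fatPoints w (ls.erase A)).filter (fun v => v ∉ A), ((ls.erase A).filter (fun L => v ∈ L)).card)
        ≤ k * (k + 1) ∨
      2 * ((ls.erase A).card +
        ∑ v ∈ (fatPoints w (ls.erase A)).filter (fun v => v ∉ A), ((ls.erase A).filter (fun L => v ∈ L)).card)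
        ≤ 4 * (k - 1) + k' * (k' + 1)) := by
  set T := ls.erase A with hT
  have hTmem : ∀ Z ∈ T, Z ∈ ls ∧ Z ≠ A := fun Z hZ => ⟨(Finset.mem_erase.1 hZ).2, (Finset.mem_erase.1 hZ).1⟩
  set FA := (fatPoints w T).filter (fun v => v ∈ A) with hFA
  set FN := (fatPoints w T).filter (fun v => v ∉ A) with hFN
  constructor
  · -- the fat points of `A`: at most `fat A` of them, degree `≤ k` each
    have hdeg : ∀ v ∈ FA, ((ls.erase A).filter (fun L => v ∈ L)).card ≤ k := by
      intro v _
      have h := deg_le_one_big h1 h2 h3 h4 hA hrest v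
      have := fat_mono w (subset_unionLR A ((ls.erase A).filter (fun L => v ∈ L)).toList)
      omega
    have hcard : FA.card ≤ fat w A := by
      refine Finset.card_le_card (fun v hv => ?_)
      have hv' := Finset.mem_filter.1 hv
      exact Finset.mem_filter.2 ⟨hv'.2, (mem_fatPoints.1 hv'.1).2⟩
    calc ∑ v ∈ FA, ((ls.erase A).filter (fun L => v ∈ L)).card ≤ ∑ _v ∈ FA, k := Finset.sum_le_sum hdeg
      _ = FA.card * k := Finset.sum_const_nat (fun _ _ => rfl)
      _ ≤ fat w A * k := Nat.mul_le_mul_right k hcard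
  · -- the new fat points: at most one
    have hFN1 : FN.card ≤ 1 := by
      rw [Finset.card_le_one]
      intro q hq r hr
      have hq' := Finset.mem_filter.1 hq
      have hr' := Finset.mem_filter.1 hr
      obtain ⟨⟨B, hB, hqB⟩, hq2⟩ := mem_fatPoints.1 hq'.1
      obtain ⟨⟨C, hC, hrC⟩, hr2⟩ := mem_fatPoints.1 hr'.1
      exact hone q r hq'.2 hr'.2 hq2 hr2 ⟨B, (hTmem B hB).1, (hTmem B hB).2, hqB⟩
        ⟨C, (hTmem C hC).1, (hTmem C hC).2, hrC⟩
    rcases (by omega : FN.card = 0 ∨ FN.card = 1) with h0 | h1'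
    · left
      rw [Finset.card_eq_zero.1 h0, Finset.sum_empty, Nat.add_zero]
      exact two_mul_card_le_one_big h1 h2 h3 h4 hA hrest (by omega)
    · right
      obtain ⟨q, hq⟩ := Finset.card_eq_one.1 h1'
      have hqF : q ∈ FN := hq ▸ Finset.mem_singleton_self q
      have hq' := Finset.mem_filter.1 hqF
      obtain ⟨⟨B, hB, hqB⟩, hq2⟩ := mem_fatPoints.1 hq'.1
      have hqA : q ∉ A := hq'.2
      rw [hq, Finset.sum_singleton]
      have hdegq := deg_new_fat_le h1 h2 h3 h4 hA hrest hqA hq2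
      have hsplit := Finset.card_filter_add_card_filter_not (s := T) (fun L => q ∈ L)
      have havoid := two_mul_card_le_of_freeCountR A k' (T.filter (fun L => q ∉ L))
        (fun L hL => ⟨hrest L (hTmem L (Finset.mem_filter.1 hL).1).1 (hTmem L (Finset.mem_filter.1 hL).1).2,
          h3 L (hTmem L (Finset.mem_filter.1 hL).1).1 A hA (hTmem L (Finset.mem_filter.1 hL).1).2⟩)
        (fun L hL L' hL' hne => h3 L (hTmem L (Finset.mem_filter.1 hL).1).1 L'
          (hTmem L' (Finset.mem_filter.1 hL').1).1 hne)
        (fun l hnd hl => by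
          have := free_avoid_le h1 h2 h4 hA hrest hqA hq2 (hTmem B hB).1 (hTmem B hB).2 hqB l hnd
            (fun L hL => ⟨(hTmem L (Finset.mem_filter.1 (hl L hL)).1).1,
              (hTmem L (Finset.mem_filter.1 (hl L hL)).1).2, (Finset.mem_filter.1 (hl L hL)).2⟩)
          omega)
      have hk1 : 1 ≤ k := by omega
      have hdeg' : ((ls.erase A).filter (fun L => q ∈ L)).card ≤ k - 1 := by omega
      rw [← hT] at hdeg'
      -- `2 (#T + deg q) = 2 (deg q + avoid + deg q) ≤ 4 (k − 1) + k' (k' + 1)`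
      have := Nat.mul_le_mul_left 4 hdeg'
      omega

include h1 h2 h3 h4 hA cA hrest in
/-- **One big line: cap sum `≤ 16`** — (α) a line with two fat points off `A`, (β′) two new fat points on distinct
lines, (β″) at most one new fat point, by the shape of `A` (`(4,0)`, `(5,0)`, `(4,1)`). -/
theorem sum_cap_le_sixteen_of_one_big : ∑ L ∈ ls, capPaper L.card (fat w L) ≤ 16 := by
  by_cases hα : ∃ B ∈ ls, B ≠ A ∧ 2 ≤ fat w (B \ A)
  · obtain ⟨B, hB, hBA, hf⟩ := hα
    exact sum_cap_le_of_two_new_fat h1 h2 h3 h4 hA cA hrest hB hBA hf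
  have hβ : ∀ B ∈ ls, B ≠ A → fat w (B \ A) ≤ 1 := fun B hB hBA => by
    by_contra hc
    exact hα ⟨B, hB, hBA, by omega⟩
  by_cases htwo : ∃ q r : β, q ∉ A ∧ r ∉ A ∧ w q = 2 ∧ w r = 2 ∧ q ≠ r ∧
      (∃ B ∈ ls, B ≠ A ∧ q ∈ B) ∧ (∃ C ∈ ls, C ≠ A ∧ r ∈ C)
  · obtain ⟨q, r, hqA, hrA, hq2, hr2, hqr, ⟨B, hB, hBA, hqB⟩, ⟨C, hC, hCA, hrC⟩⟩ := htwo
    exact sum_cap_le_of_two_new_fat_points h1 h2 h3 h4 hA cA hrest hβ hqA hrA hq2 hr2 hqr hB hBA hqB hC hCA hrC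
  have hone : ∀ q r : β, q ∉ A → r ∉ A → w q = 2 → w r = 2 →
      (∃ B ∈ ls, B ≠ A ∧ q ∈ B) → (∃ C ∈ ls, C ≠ A ∧ r ∈ C) → q = r := by
    intro q r hqA hrA hq2 hr2 hB hC
    by_contra hne
    exact htwo ⟨q, r, hqA, hrA, hq2, hr2, hne, hB, hC⟩
  set T := ls.erase A with hT
  have hTmem : ∀ Z ∈ T, Z ∈ ls ∧ Z ≠ A := fun Z hZ => ⟨(Finset.mem_erase.1 hZ).2, (Finset.mem_erase.1 hZ).1⟩
  rw [← Finset.add_sum_erase ls _ hA, ← hT,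
    sum_cap_eq_card_add_sum_fat' (fun L hL => hrest L (hTmem L hL).1 (hTmem L hL).2)
      (fun L hL => h1 L (hTmem L hL).1) (fun L hL => (h2 L (hTmem L hL).1).2), sum_fat_eq_sum_deg,
    ← Finset.sum_filter_add_sum_filter_not (fatPoints w T) (fun v => v ∈ A)]
  have h2A := h2 A hA
  have hwA := wsum_eq_card_add_fat w A (h1 A hA)
  rcases (by omega : (A.card = 4 ∧ fat w A = 0) ∨ (A.card = 5 ∧ fat w A = 0) ∨ (A.card = 4 ∧ fat w A = 1))
    with ⟨e, f⟩ | ⟨e, f⟩ | ⟨e, f⟩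
  · obtain ⟨hFA, hFN⟩ := bounds_of_one_new_fat h1 h2 h3 h4 hA hrest hone (k := 4) (k' := 2) (by omega) (by omega)
    rw [← hT] at hFA hFN
    rw [f] at hFA
    rw [e, f]
    have : capPaper 4 0 = 4 := by decide
    rw [this]
    omega
  · obtain ⟨hFA, hFN⟩ := bounds_of_one_new_fat h1 h2 h3 h4 hA hrest hone (k := 3) (k' := 1) (by omega) (by omega)
    rw [← hT] at hFA hFN
    rw [f] at hFA
    rw [e, f]
    have : capPaper 5 0 = 5 := by decide
    rw [this]
    omega
  · obtain ⟨hFA, hFN⟩ := bounds_of_one_new_fat h1 h2 h3 h4 hA hrest hone (k := 3) (k' := 1) (by omega) (by omega)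
    rw [← hT] at hFA hFN
    rw [f] at hFA
    rw [e, f]
    have : capPaper 4 1 = 5 := by decide
    rw [this]
    omega

end OneBigFinal

end FourCap

end S1

end PercRepro
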